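import Literature.Probability.Percolation.HexLatticeSegments
import Literature.Probability.Percolation.CLE6Proofs
import Literature.Probability.RandomPlanarGeometry.PolylineDyadicClock
import Literature.Probability.LatticeModels.DomainDiscretisation
import Literature.Probability.RandomPlanarGeometry.USTPeanoSegments

/-!
# The polyline of a self-avoiding walk of `δℤ²` is simple up to its constant tail
# (route `SAWReversalUpgrade`, helper for item `AttachmentExists`, stmt-CriticalPhenomena-18009)

Elementary planar geometry of the square lattice `δℤ² ⊆ ℂ` (`meshPoint δ`): two distinct closed
unit edges meet only at a common endpoint (`grid_meshPoint_edge_inter`). Consequently the pieces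
of the polyline of a self-avoiding walk are well separated (`grid_goodPieces_of_isPath`, in the
sense of `Literature.Probability.Percolation.GoodPieces`), and the dyadic parametrisation
`SimpleGraph.Walk.toCurve (meshPoint δ)` of a self-avoiding walk of the discrete domain
`Ω_δ = discreteDomainGraph Ω δ` is injective up to its final constant stretch
`[1 - 2^{-n}, 1]` (`grid_tailStart_le_of_toCurve_eq`, `grid_toCurve_eq_of_tailStart_le`), and
stays in `closure Ω` (`grid_toCurve_mem_closure`).

Folklore; the hexagonal-lattice analogue is `HexLatticeSegments.lean`.
-/

noncomputable section

namespace Summit.CriticalPhenomena.SAWScalingLimit.Theorems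

open Set Function
open scoped unitInterval
open Literature.Probability.LatticeModels Literature.Probability.Percolation
open Literature.Probability.RandomPlanarGeometry (dyadicTime coe_dyadicTime polylineFrom_apply_of_le)

/-! ### Unit edges of `ℤ²` -/

/-- Coordinates of a point of the side `[a, a + eᵢ]` of `ℤ² ⊆ ℂ`. [folklore] -/
theorem grid_coords_of_mem_side {a : Site 2} {i : Fin 2} {q : ℂ}
    (hq : q ∈ segment ℝ (Site.toComplex a) (Site.toComplex (a + Pi.single i 1))) :
    (i = 0 → q.im = a 1 ∧ (a 0 : ℝ) ≤ q.re ∧ q.re ≤ a 0 + 1) ∧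
      (i = 1 → q.re = a 0 ∧ (a 1 : ℝ) ≤ q.im ∧ q.im ≤ a 1 + 1) := by
  rw [segment_eq_image'] at hq
  obtain ⟨t, ⟨ht0, ht1⟩, rfl⟩ := hq
  constructor
  · rintro rfl
    simp only [Complex.add_im, Complex.smul_im, Complex.sub_im, Site.toComplex_im, Pi.add_apply,
      Complex.add_re, Complex.smul_re, Complex.sub_re, Site.toComplex_re, smul_eq_mul]
    simp only [Pi.single_apply, Fin.one_eq_zero_iff, OfNat.ofNat_ne_one, ↓reduceIte, add_zero,
      sub_self, mul_zero, Int.cast_add, Int.cast_one, true_and]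
    constructor <;> nlinarith
  · rintro rfl
    simp only [Complex.add_im, Complex.smul_im, Complex.sub_im, Site.toComplex_im, Pi.add_apply,
      Complex.add_re, Complex.smul_re, Complex.sub_re, Site.toComplex_re, smul_eq_mul]
    simp only [Pi.single_apply, Fin.zero_eq_one_iff, OfNat.ofNat_ne_one, ↓reduceIte,
      add_zero, sub_self, mul_zero, Int.cast_add, Int.cast_one, true_and]
    constructor <;> nlinarith

/-- **A lattice point on a side is one of its endpoints.** [folklore] -/
theorem grid_eq_of_toComplex_mem_side {a w : Site 2} {i : Fin 2}
    (hw : Site.toComplex w ∈ segment ℝ (Site.toComplex a) (Site.toComplex (a + Pi.single i 1))) :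
    w = a ∨ w = a + Pi.single i 1 := by
  obtain ⟨h0, h1⟩ := grid_coords_of_mem_side hw
  fin_cases i
  · obtain ⟨him, hre1, hre2⟩ := h0 rfl
    simp only [Site.toComplex_im, Site.toComplex_re, Int.cast_inj] at him hre1 hre2
    rcases Literature.Probability.RandomPlanarGeometry.USTPeano.int_eq_or_of_le_of_le hre1 hre2 with h | h
    · left; ext j; fin_cases j <;> simp [h, him]
    · right; ext j; fin_cases j <;> simp [h, him]
  · obtain ⟨hre, him1, him2⟩ := h1 rfl
    simp only [Site.toComplex_im, Site.toComplex_re, Int.cast_inj] at hre him1 him2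
    rcases Literature.Probability.RandomPlanarGeometry.USTPeano.int_eq_or_of_le_of_le him1 him2 with h | h
    · left; ext j; fin_cases j <;> simp [h, hre]
    · right; ext j; fin_cases j <;> simp [h, hre]

/-- Two integers whose unit intervals `[n, n+1]`, `[n', n'+1]` contain a common non-integer real
are equal. [folklore] -/
theorem grid_int_eq_of_mem_Icc {n n' : ℤ} {r : ℝ} (hr : ∀ m : ℤ, r ≠ m) (h1 : (n : ℝ) ≤ r)
    (h2 : r ≤ n + 1) (h1' : (n' : ℝ) ≤ r) (h2' : r ≤ n' + 1) : n = n' := by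
  have a1 : (n : ℝ) < r := lt_of_le_of_ne h1 fun h => hr n h.symm
  have a2 : r < n + 1 := lt_of_le_of_ne h2 fun h => hr (n + 1) (by push_cast; exact h)
  have a1' : (n' : ℝ) < r := lt_of_le_of_ne h1' fun h => hr n' h.symm
  have a2' : r < n' + 1 := lt_of_le_of_ne h2' fun h => hr (n' + 1) (by push_cast; exact h)
  have b1 : (n : ℝ) < n' + 1 := a1.trans a2'
  have b2 : (n' : ℝ) < n + 1 := a1'.trans a2
  have c1 : n < n' + 1 := by exact_mod_cast b1
  have c2 : n' < n + 1 := by exact_mod_cast b2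
  omega

/-- **Two different sides of `ℤ²` meet only at lattice points.** [folklore] -/
theorem grid_exists_site_of_mem_sides {a a' : Site 2} {i i' : Fin 2} {q : ℂ}
    (hq : q ∈ segment ℝ (Site.toComplex a) (Site.toComplex (a + Pi.single i 1)))
    (hq' : q ∈ segment ℝ (Site.toComplex a') (Site.toComplex (a' + Pi.single i' 1)))
    (hne : (a, i) ≠ (a', i')) : ∃ w : Site 2, q = Site.toComplex w := by
  obtain ⟨h0, h1⟩ := grid_coords_of_mem_side hq
  obtain ⟨h0', h1'⟩ := grid_coords_of_mem_side hq'
  -- a lattice point, given integer coordinates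
  have mk : ∀ m n : ℤ, q.re = m → q.im = n → ∃ w : Site 2, q = Site.toComplex w := by
    intro m n hm hn
    exact ⟨![m, n], Complex.ext (by simp [hm]) (by simp [hn])⟩
  fin_cases i <;> fin_cases i'
  · obtain ⟨him, hre1, hre2⟩ := h0 rfl
    obtain ⟨him', hre1', hre2'⟩ := h0' rfl
    by_cases hint : ∃ m : ℤ, q.re = m
    · obtain ⟨m, hm⟩ := hint
      exact mk m (a 1) hm him
    · exfalso
      have hint' : ∀ m : ℤ, q.re ≠ m := fun m hm => hint ⟨m, hm⟩
      have e0 : a 0 = a' 0 := grid_int_eq_of_mem_Icc hint' hre1 hre2 hre1' hre2'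
      have e1 : a 1 = a' 1 := by exact_mod_cast him.symm.trans him'
      refine hne (Prod.ext ?_ rfl)
      ext j; fin_cases j
      · exact e0
      · exact e1
  · obtain ⟨him, -, -⟩ := h0 rfl
    obtain ⟨hre', -, -⟩ := h1' rfl
    exact mk (a' 0) (a 1) hre' him
  · obtain ⟨hre, -, -⟩ := h1 rfl
    obtain ⟨him', -, -⟩ := h0' rfl
    exact mk (a 0) (a' 1) hre him'
  · obtain ⟨hre, him1, him2⟩ := h1 rfl
    obtain ⟨hre', him1', him2'⟩ := h1' rfl
    by_cases hint : ∃ m : ℤ, q.im = m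
    · obtain ⟨m, hm⟩ := hint
      exact mk (a 0) m hre hm
    · exfalso
      have hint' : ∀ m : ℤ, q.im ≠ m := fun m hm => hint ⟨m, hm⟩
      have e1 : a 1 = a' 1 := grid_int_eq_of_mem_Icc hint' him1 him2 him1' him2'
      have e0 : a 0 = a' 0 := by exact_mod_cast hre.symm.trans hre'
      refine hne (Prod.ext ?_ rfl)
      ext j; fin_cases j
      · exact e0
      · exact e1

/-- Every edge of `ℤ²` is a side `[a, a + eᵢ]` (in one of the two orders). [folklore] -/
theorem grid_exists_side_of_adj {x y : Site 2} (h : (zdGraph 2).Adj x y) :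
    ∃ (a : Site 2) (i : Fin 2), ((x = a ∧ y = a + Pi.single i 1) ∨ (y = a ∧ x = a + Pi.single i 1)) ∧
      segment ℝ (Site.toComplex x) (Site.toComplex y) =
        segment ℝ (Site.toComplex a) (Site.toComplex (a + Pi.single i 1)) := by
  obtain ⟨i, h | h⟩ := (zdGraph_adj_iff x y).1 h
  · exact ⟨x, i, Or.inl ⟨rfl, h⟩, by rw [h]⟩
  · exact ⟨y, i, Or.inr ⟨rfl, h⟩, by rw [h, segment_symm]⟩

/-- **Two distinct closed unit edges of `ℤ²` meet only at a common endpoint.** [folklore] -/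
theorem grid_edge_inter {x y x' y' : Site 2} (hxy : (zdGraph 2).Adj x y)
    (hxy' : (zdGraph 2).Adj x' y') {q : ℂ}
    (hq : q ∈ segment ℝ (Site.toComplex x) (Site.toComplex y))
    (hq' : q ∈ segment ℝ (Site.toComplex x') (Site.toComplex y')) (hne : s(x, y) ≠ s(x', y')) :
    ∃ w : Site 2, q = Site.toComplex w ∧ (w = x ∨ w = y) ∧ (w = x' ∨ w = y') := by
  obtain ⟨a, i, hor, hseg⟩ := grid_exists_side_of_adj hxy
  obtain ⟨a', i', hor', hseg'⟩ := grid_exists_side_of_adj hxy'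
  rw [hseg] at hq
  rw [hseg'] at hq'
  have hne' : (a, i) ≠ (a', i') := by
    intro h
    simp only [Prod.mk.injEq] at h
    obtain ⟨rfl, rfl⟩ := h
    apply hne
    rcases hor with ⟨rfl, rfl⟩ | ⟨rfl, rfl⟩ <;> rcases hor' with ⟨rfl, rfl⟩ | ⟨rfl, rfl⟩
    · rfl
    · exact Sym2.eq_swap
    · exact Sym2.eq_swap
    · rfl
  obtain ⟨w, rfl⟩ := grid_exists_site_of_mem_sides hq hq' hne'
  refine ⟨w, rfl, ?_, ?_⟩
  · rcases grid_eq_of_toComplex_mem_side hq with rfl | rfl <;>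
      rcases hor with ⟨rfl, rfl⟩ | ⟨rfl, rfl⟩ <;> simp
  · rcases grid_eq_of_toComplex_mem_side hq' with rfl | rfl <;>
      rcases hor' with ⟨rfl, rfl⟩ | ⟨rfl, rfl⟩ <;> simp

/-- A point of the rescaled segment `[δX, δY]` is `δ q` with `q ∈ [X, Y]`. [folklore] -/
theorem grid_exists_of_mem_segment_meshPoint {δ : ℝ} {x y : Site 2} {z : ℂ}
    (hz : z ∈ segment ℝ (meshPoint δ x) (meshPoint δ y)) :
    ∃ q ∈ segment ℝ (Site.toComplex x) (Site.toComplex y), z = (δ : ℂ) * q := by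
  rw [segment_eq_image'] at hz
  obtain ⟨t, ht, rfl⟩ := hz
  refine ⟨Site.toComplex x + t • (Site.toComplex y - Site.toComplex x), ?_, ?_⟩
  · rw [segment_eq_image']
    exact ⟨t, ht, rfl⟩
  · simp only [meshPoint, Complex.real_smul]
    ring

/-- **Two distinct closed unit edges of `δℤ²` (`δ ≠ 0`) meet only at a common endpoint.**
[folklore] -/
theorem grid_meshPoint_edge_inter {δ : ℝ} (hδ : δ ≠ 0) {x y x' y' : Site 2}
    (hxy : (zdGraph 2).Adj x y) (hxy' : (zdGraph 2).Adj x' y') {z : ℂ}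
    (hz : z ∈ segment ℝ (meshPoint δ x) (meshPoint δ y))
    (hz' : z ∈ segment ℝ (meshPoint δ x') (meshPoint δ y')) (hne : s(x, y) ≠ s(x', y')) :
    ∃ w : Site 2, z = meshPoint δ w ∧ (w = x ∨ w = y) ∧ (w = x' ∨ w = y') := by
  obtain ⟨q, hq, rfl⟩ := grid_exists_of_mem_segment_meshPoint hz
  obtain ⟨q', hq', heq⟩ := grid_exists_of_mem_segment_meshPoint hz'
  have hδ' : (δ : ℂ) ≠ 0 := Complex.ofReal_ne_zero.2 hδ
  have hqq' : q = q' := mul_left_cancel₀ hδ' heq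
  subst hqq'
  obtain ⟨w, rfl, h1, h2⟩ := grid_edge_inter hxy hxy' hq hq' hne
  exact ⟨w, rfl, h1, h2⟩

/-! ### Self-avoiding walks of `Ω_δ` -/

/-- `meshPoint δ` is injective for `δ ≠ 0`. [folklore] -/
theorem grid_meshPoint_injective {δ : ℝ} (hδ : δ ≠ 0) : Injective (meshPoint δ) := fun x y h => by
  rw [← nearestSite_meshPoint hδ x, ← nearestSite_meshPoint hδ y, h]

/-- **The pieces of the polyline of a self-avoiding walk of `Ω_δ` are well separated**
(`GoodPieces`): consecutive mesh points are distinct, and the `k`-th closed edge meets a later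
one only at its endpoint `p (k+1)`. [folklore] -/
theorem grid_goodPieces_of_isPath {Ω : Set ℂ} {δ : ℝ} (hδ : δ ≠ 0) {u v : Site 2}
    (γ : (discreteDomainGraph Ω δ).Walk u v) (hγ : γ.IsPath) :
    GoodPieces (fun k => meshPoint δ (γ.getVert k)) γ.length := by
  have hadj : ∀ k, k < γ.length → (zdGraph 2).Adj (γ.getVert k) (γ.getVert (k + 1)) := fun k hk =>
    meshGraph_le_zdGraph Ω δ (discreteDomainGraph_le_meshGraph Ω δ (γ.adj_getVert_succ hk))
  have hinj := hγ.getVert_injOn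
  refine ⟨fun k hk h => (hadj k hk).ne (grid_meshPoint_injective hδ h), ?_⟩
  intro k m hkm hm z hz hz'
  have hk : k < γ.length := hkm.trans hm
  have hI : ∀ {i j : ℕ}, i ≤ γ.length → j ≤ γ.length → γ.getVert i = γ.getVert j → i = j :=
    fun hi hj h => hinj hi hj h
  have hne : s(γ.getVert k, γ.getVert (k + 1)) ≠ s(γ.getVert m, γ.getVert (m + 1)) := by
    intro h
    rcases Sym2.eq_iff.1 h with ⟨h1, -⟩ | ⟨h1, -⟩
    · have := hI hk.le hm.le h1; omega
    · have := hI hk.le (by omega) h1; omega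
  obtain ⟨w, rfl, hw, hw'⟩ := grid_meshPoint_edge_inter hδ (hadj k hk) (hadj m hm) hz hz' hne
  rcases hw with rfl | rfl
  · exfalso
    rcases hw' with h | h
    · have := hI hk.le hm.le h; omega
    · have := hI hk.le (by omega) h; omega
  · rfl

/-! ### The curve of a walk as `polylineFrom` through `ptsList` -/

/-- The embedded support of a walk is the list `p 0 :: [p 1, …, p n]` of its embedded vertices
`p k = emb (w.getVert k)`. [folklore] -/
theorem grid_support_map_eq_ptsList {V E : Type*} [AddCommGroup E] [Module ℝ E]
    [TopologicalSpace E] [ContinuousAdd E] [ContinuousSMul ℝ E] {G : SimpleGraph V} (emb : V → E) :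
    ∀ {u v : V} (w : G.Walk u v),
      w.support.map emb = emb (w.getVert 0) :: ptsList (fun k => emb (w.getVert k)) w.length
  | _, _, SimpleGraph.Walk.nil => by simp [ptsList]
  | _, _, SimpleGraph.Walk.cons h q => by
    rw [SimpleGraph.Walk.support_cons, List.map_cons, grid_support_map_eq_ptsList emb q]
    simp only [SimpleGraph.Walk.length_cons, ptsList, SimpleGraph.Walk.getVert_zero,
      SimpleGraph.Walk.getVert_cons_succ]

/-- **The curve of a walk is the polyline through its embedded vertices**
`p 0, …, p n` (`p k = emb (w.getVert k)`). [folklore] -/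
theorem grid_toCurve_eq_polylineFrom {V E : Type*} [AddCommGroup E] [Module ℝ E]
    [TopologicalSpace E] [ContinuousAdd E] [ContinuousSMul ℝ E] {G : SimpleGraph V} (emb : V → E)
    {u v : V} (w : G.Walk u v) (t : I) :
    w.toCurve emb t = (polylineFrom (emb (w.getVert 0))
      (ptsList (fun k => emb (w.getVert k)) w.length)).2 t := by
  rw [SimpleGraph.Walk.toCurve, grid_support_map_eq_ptsList emb w]
  rfl

/-- **Injectivity up to the constant tail**: if the polyline of a self-avoiding walk of `Ω_δ`
(`δ ≠ 0`) takes the same value at times `s < t`, then `s` lies in the final constant stretch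
`[1 - 2^{-n}, 1]`, `n` the length of the walk. [folklore] -/
theorem grid_tailStart_le_of_toCurve_eq {Ω : Set ℂ} {δ : ℝ} (hδ : δ ≠ 0) {u v : Site 2}
    (γ : (discreteDomainGraph Ω δ).Walk u v) (hγ : γ.IsPath) {s t : I} (hst : s < t)
    (heq : γ.toCurve (meshPoint δ) s = γ.toCurve (meshPoint δ) t) :
    tailStart γ.length ≤ (s : ℝ) := by
  rw [grid_toCurve_eq_polylineFrom, grid_toCurve_eq_polylineFrom] at heq
  exact tailStart_le_of_polylineFrom_eq (fun k => meshPoint δ (γ.getVert k)) γ.length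
    (grid_goodPieces_of_isPath hδ γ hγ) hst heq

/-- **The constant tail**: after time `1 - 2^{-n}` the polyline of a walk rests at its final
vertex. [folklore] -/
theorem grid_toCurve_eq_of_tailStart_le {V E : Type*} [NormedAddCommGroup E] [NormedSpace ℝ E]
    {G : SimpleGraph V} (emb : V → E)
    {u v : V} (w : G.Walk u v) {t : I} (ht : tailStart w.length ≤ (t : ℝ)) :
    w.toCurve emb t = emb v := by
  rw [grid_toCurve_eq_polylineFrom]
  have hlen : (ptsList (fun k => emb (w.getVert k)) w.length).length = w.length := length_ptsList _ _
  have ht' : (dyadicTime (ptsList (fun k => emb (w.getVert k)) w.length).length : ℝ) ≤ t := by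
    rw [hlen, coe_dyadicTime]; exact ht
  rw [polylineFrom_apply_of_le _ _ ht', ← polylineFrom_fst]
  have h := polylineFrom_ptsList_fst (fun k => emb (w.getVert k)) w.length
  rw [SimpleGraph.Walk.getVert_length] at h
  exact h

/-- **The polyline of a walk of `Ω_δ` stays in `closure Ω`** (its edges are closed segments in
`Ω̄`; the base vertex is assumed to be drawn in `Ω̄`, which is automatic for a mesh vertex).
[folklore] -/
theorem grid_toCurve_mem_closure {Ω : Set ℂ} {δ : ℝ} {u v : Site 2}
    (γ : (discreteDomainGraph Ω δ).Walk u v) (hu : meshPoint δ u ∈ closure Ω) (t : I) :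
    γ.toCurve (meshPoint δ) t ∈ closure Ω := by
  refine SimpleGraph.Walk.range_toCurve_subset γ hu (fun d hd => ?_) ⟨t, rfl⟩
  exact (meshGraph_adj_iff.1 (discreteDomainGraph_le_meshGraph Ω δ d.adj)).2

/-- The endpoints of the polyline of a walk: `toCurve 0 = δu`, `toCurve 1 = δv`. [folklore] -/
theorem grid_toCurve_zero_one {V E : Type*} [NormedAddCommGroup E] [NormedSpace ℝ E]
    {G : SimpleGraph V} (emb : V → E)
    {u v : V} (w : G.Walk u v) : w.toCurve emb 0 = emb u ∧ w.toCurve emb 1 = emb v :=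
  ⟨SimpleGraph.Walk.toCurve_apply_zero emb w,
    grid_toCurve_eq_of_tailStart_le emb w (t := 1) (tailStart_lt_one _).le⟩

end Summit.CriticalPhenomena.SAWScalingLimit.Theorems
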